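import Summits.ResolutionOfSingularities.ResolutionOfSingularities.Theorems.FrobeniusClosingPatchingRelPerfectDepthMultiHostFormatSncCyl
import Summits.ResolutionOfSingularities.ResolutionOfSingularities.Theorems.FrobeniusClosingPatchingRelPerfectDepthMultiHostCylSnc
import HarnessLib

/-!
# Crux `PatchingRelPerfect` (stmt-ResolutionOfSingularities-16161), chain W5.2 — F7(β) d = 2 (β-AX), X2c = T2c PROPER:
# at CJS end a cylinder state is FORMAT-SNC END on its cylinder region (`FormatEndOnCyl₂` content)

[OURS · L1 W5.2 · F7(β) (β-AX) X2c · res-L1-w52-plan-1 spec v4.1 §6 A1 T2c, NOTE G11-22 (CYL-SNC by res-D-pv-034 `CylState.hasSNC_cylinder`,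
consumed BY NAME), targets scratch v3 `FormatEndOnCyl₂`.]  Replaces the role of NO printed item; NOT a statement of the manuscript under
review; fact-free.  AI-written; AI review is weaker than expert review.  No definitions.

* **`CylState.isFormatSncOn_of_cjsEnd`** — ONE snc family `𝓔` on the carrier containing the member traces `bd T` and presenting every host
  trace as a monomial (`∀ i, ∃ c, tr i = monomialIdeal (𝓔.map (T ↦ (T, c T)))`, the output of res-D-pv-054's `transport_of_cjsB` /
  `end_components`) ⇒ `∃ 𝓗, S.IsFormatSncOn cyl.V (𝓔.map cyl.globalise) 𝓗` — CYL-SNC (`hasSNC_cylinder`, from `CylState.param` and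
  `S.snc`) feeds `exists_isFormatSncOn_globalise_of_traces` (p550128).  No regularity / `Nodup` / irreducibility hypothesis is used.
* `CylState.exists_isFormatSncOn_of_cjsEnd` — the `∃ 𝓒 𝓗` form with the binder list of `FormatEndOnCyl₂` (extra hypotheses unused).

## References
* E. Bierstone, D. Grigoriev, P. Milman, J. Włodarczyk (2011), Def. 3.1.1, Def. 3.1.3. [BierstoneGrigorievMilmanWlodarczyk2011]
* J. Kollár, *Lectures on Resolution of Singularities* (2007), (3.111) Steps 1–3. [Kollar2007]
-/

-- `Summit.<Summit>.<Sub>.Theorems` with `Sub = Summit` (single-conjunct summit, D-0017)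
set_option linter.dupNamespace false

noncomputable section

open CategoryTheory AlgebraicGeometry TopologicalSpace
open Literature.AlgebraicGeometry.Resolution
open Scheme.IdealSheafData

namespace Summit.ResolutionOfSingularities.ResolutionOfSingularities.Theorems.DepthMultiHost

universe u

namespace CylState

variable {X : Scheme.{u}} [IsLocallyNoetherian X] {S : MultiHostState X} (cyl : CylState S)

/-- **T2c with explicit exponent functions**: CYL-SNC + `isFormatSncOn_globalise_of_traces`. [cite: BierstoneGrigorievMilmanWlodarczyk2011, Def. 3.1.3]
[cite: Kollar2007, (3.111) Steps 1–3] -/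
theorem isFormatSncOn_globalise_of_hasSNC (𝓔 : List cyl.Z.IdealSheafData) (h𝓔 : HasSNC 𝓔) (c : Fin S.n → cyl.Z.IdealSheafData → ℕ)
    (htr : ∀ i, cyl.tr i = monomialIdeal (𝓔.map fun D => (D, c i D))) (hbd : ∀ T ∈ S.𝓔, T ≠ cyl.j.ker → cyl.bd T ∈ 𝓔) :
    S.IsFormatSncOn cyl.V (𝓔.map cyl.globalise) fun i => (𝓔.map fun D => (cyl.globalise D, c i D)) ++ S.𝓔.map fun T => (T, 0) :=
  cyl.isFormatSncOn_globalise_of_traces 𝓔 c htr hbd (cyl.hasSNC_cylinder 𝓔 h𝓔)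
    (fun D hD => List.mem_cons_of_mem _ (List.mem_map.mpr ⟨D, hD, rfl⟩)) (List.mem_cons_self ..)

/-- **T2c `CylState.isFormatSncOn_of_cjsEnd`** (res-L1-w52-plan-1 spec v4.1 §6 A1): at CJS end — ONE snc family `𝓔` on the carrier containing
the member traces and presenting every host trace as a monomial — the state is FORMAT-SNC END on the cylinder region `cyl.V`, with components
the member-aware globalisations `𝓔.map cyl.globalise`. [cite: BierstoneGrigorievMilmanWlodarczyk2011, Def. 3.1.1 and Def. 3.1.3]
[cite: Kollar2007, (3.111) Steps 1–3] -/
theorem isFormatSncOn_of_cjsEnd (𝓔 : List cyl.Z.IdealSheafData) (h𝓔 : HasSNC 𝓔) (hbd : ∀ T ∈ S.𝓔, T ≠ cyl.j.ker → cyl.bd T ∈ 𝓔)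
    (htr : ∀ i, ∃ c : cyl.Z.IdealSheafData → ℕ, cyl.tr i = monomialIdeal (𝓔.map fun D => (D, c D))) :
    ∃ 𝓗 : Fin S.n → List (X.IdealSheafData × ℕ), S.IsFormatSncOn cyl.V (𝓔.map cyl.globalise) 𝓗 := by
  choose c hc using htr
  exact ⟨_, cyl.isFormatSncOn_globalise_of_hasSNC 𝓔 h𝓔 c hc hbd⟩

omit [IsLocallyNoetherian X] in
/-- **`FormatEndOnCyl₂` content** (targets scratch v3, binder list verbatim; the regularity / `Nodup` / irreducibility hypotheses are not
needed and ignored). [cite: BierstoneGrigorievMilmanWlodarczyk2011, Def. 3.1.3] -/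
theorem exists_isFormatSncOn_of_cjsEnd {X : Scheme.{u}} [IsNoetherian X] (_hX : Scheme.IsRegular X) (S : MultiHostState X)
    (cyl : CylState S) [IsIntegral cyl.Z] [IsNoetherian cyl.Z] (_hZ : Scheme.IsRegular cyl.Z) (𝓔 : List cyl.Z.IdealSheafData)
    (h𝓔 : HasSNC 𝓔) (_hnd : 𝓔.Nodup) (_hirr : ∀ T ∈ 𝓔, T ≠ ⊤ → IsIrreducible (T.support : Set cyl.Z))
    (hbd : ∀ T ∈ S.𝓔, T ≠ cyl.j.ker → cyl.bd T ∈ 𝓔)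
    (htr : ∀ i, ∃ c : cyl.Z.IdealSheafData → ℕ, cyl.tr i = monomialIdeal (𝓔.map fun T => (T, c T))) :
    ∃ (𝓒 : List X.IdealSheafData) (𝓗 : Fin S.n → List (X.IdealSheafData × ℕ)), S.IsFormatSncOn cyl.V 𝓒 𝓗 :=
  ⟨_, cyl.isFormatSncOn_of_cjsEnd 𝓔 h𝓔 hbd htr⟩

end CylState

end Summit.ResolutionOfSingularities.ResolutionOfSingularities.Theorems.DepthMultiHost

end
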